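import Summits.ABC.IUTFork.Joshi.TestIsmScalingDictionary
import Summits.ABC.IUTFork.Joshi.TestDictionaryCalibration
import HarnessLib

/-!
# Branch E TEST vs S — the two satisfiable horns of X-01's hypothesis set, side by side (calibration instances at X-07′)

Record file of the abc-iut cell, branch E (rung LADDER-ABC:A2.E; seat abc-iut-E-t42, cx hand #3), a SMALL COMPLEMENT composing
abc-iut-E-t41's X-07′ files (`Joshi/TestIsmScaling{Shells,,Results,Dictionary}.lean`: the Joshi-style instantiation `scalFull p` /
`scalSetting p` with `ism :=` all ℚ-linear automorphisms, S reached by the one (Ind2)-family `untiltFamily`, typed Statement UNDEFINED,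
and the NON-DEGENERATE dictionary `IsmScaling.scalDictionary`) with this seat's floor (`Joshi/TestDictionaryFloor.lean` p429619) and
calibration (`Joshi/TestDictionaryCalibration.lean` p430744). Nothing of E-t41's content is re-proved; proof-only, 0 definitions.
**No side is taken** on [IUTchIII] Cor. 3.12 or on any author (Mochizuki / Scholze–Stix / Joshi); Joshi's papers (arXiv:2401.13508v4 …)
are unrefereed preprints cited as such; typed ≠ proved; a model EXHIBITS satisfiability of typed hypotheses, nothing more; toy level.

* §1 The calibration's test shapes at X-07′: `UniformIndRelated` and `DictionaryRealizable` HOLD there (witness = E-t41's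
  `scalDictionary`, or the datum-level `scalSetting_pilotKummerCompat` through `uniformIndRelated_of_pilotKummerCompat`, (hρ) being
  E-t41's `scalRegion_equivariant` for EVERY family) — so TEST-LEDGER reads, by decl: `DictionaryRealizable` TRUE at the floor P♭
  (DEGENERATE, `floor_dictionaryRealizable`), TRUE at X-07′ (NON-DEGENERATE, `scalSetting_dictionaryRealizable`), FALSE at the pinned
  countermodel (`pinnedSetting_not_dictionaryRealizable`).
* §2 `dictionary_models_contrast`: the two satisfiable horns in ONE theorem — (i) no move, volume-INVARIANT indeterminacies, q-datum =
  Θ-monoid, typed Statement ATTAINED (floor); (ii) one rescaling (Ind2)-move, volume-NON-invariant, honest q-datum ≠ Θ-monoid, `−|log(Θ)| = ⊤`,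
  typed Statement FALSE (X-07′). The third horn (volume-invariant indeterminacies with honest volumes ⇒ NO model) is X-06 / X-06-REAL
  (abc-iut-E-cx p428758, abc-iut-E-t43 p430041), cited not re-proved. Located, not adjudicated: which (Ind2) [IUTchIII] intends is the
  E6 attach point (Mochizuki2024JoshiReport (ShtAns) ↔ [J-III] §8.11.1 p.91 l.44–46).
[claim: Joshi2024ATS3, status: disputed] [claim: Mochizuki2012, status: disputed]
-/

noncomputable section

open Set

namespace Summit.ABC.IUTFork.Joshi

open Thm311 Cor312 Cor312Vol Cor312.Checks Cor312.IdentifiedNonVacuity Cor312Vol.NaiveWitness Cor312Vol.GluedMonoids.Naive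
  Literature.IUT.LogThetaLattice IsmScaling

variable (p : ℕ) [hp : Fact p.Prime]

/-! ## 1. The calibration's shapes at the Joshi-style instantiation -/

omit hp in
/-- (hρ) at E-t41's model in the calibration's binder shape (restriction of `scalRegion_equivariant`, which holds for EVERY family). [folklore] -/
theorem scal_hρ :
    ∀ Φ ∈ Subgroup.closure ((scalFull p).toLatticeSituation.L.Ind1Family ∪ (scalFull p).toLatticeSituation.L.Ind2Family),
      ∀ (Ψ : ∀ v : toyIndex.V, v ∈ toyIndex.Vbad → Set ((scalFull p).toLatticeSituation.L.StarPacket v))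
        (j : toyIndex.Label) (vQ : toyIndex.VQ),
        scalRegion p (fun v hv => (scalFull p).toLatticeSituation.L.starAut Φ v '' Ψ v hv) j vQ = Φ j vQ '' scalRegion p Ψ j vQ :=
  fun Φ _ Ψ j vQ => scalRegion_equivariant p Φ Ψ j vQ

/-- **`DictionaryRealizable` HOLDS at X-07′ — NON-DEGENERATELY**: the witness is E-t41's `scalDictionary` (one genuine move). [folklore] -/
theorem scalSetting_dictionaryRealizable :
    DictionaryRealizable (scalFull p).toLatticeSituation (scalSetting p) (scalRegion p) (PinnedWitness.qDatum p) :=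
  ⟨scalDictionary p, scalDictionary_baseIsThetaPilot p, scalDictionary_movesAreInd p, scalDictionary_datumEquivariant p,
    scalDictionary_stdReachable p, scalDictionary_standardPointIsQPilot p⟩

/-- **`UniformIndRelated` HOLDS at X-07′** (calibration `uniformIndRelated_of_dictionaryRealizable` under (hρ); equivalently from the
datum-level `scalSetting_pilotKummerCompat`). [claim: Mochizuki2012, status: disputed] -/
theorem scalSetting_uniformIndRelated :
    UniformIndRelated (scalFull p).toLatticeSituation (scalSetting p) (scalRegion p) (PinnedWitness.qDatum p) :=
  uniformIndRelated_of_dictionaryRealizable (scal_hρ p) (scalSetting_dictionaryRealizable p)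

/-- The same from the DATUM-level printed clause (E-t41 `scalSetting_pilotKummerCompat` + Thm. 3.11 (ii)(b)), as a cross-check of the
calibration's `uniformIndRelated_of_pilotKummerCompat`. [claim: Mochizuki2012, status: disputed] -/
theorem scalSetting_uniformIndRelated' :
    UniformIndRelated (scalFull p).toLatticeSituation (scalSetting p) (scalRegion p) (PinnedWitness.qDatum p) :=
  uniformIndRelated_of_pilotKummerCompat (scal_partII p (scalSetting p).n).2.1 (scal_hρ p) (scalSetting_pilotKummerCompat p)

/-- **The three evaluations of `DictionaryRealizable` of record**: TRUE at the floor (degenerate), TRUE at X-07′ (non-degenerate), FALSE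
at the pinned countermodel. [folklore] -/
theorem dictionaryRealizable_evaluations :
    DictionaryRealizable (naiveFull p).toLatticeSituation (expSetting p expSq) (ballOfMonoid p) (fun v _ => qDatumExp p expSq v) ∧
      DictionaryRealizable (scalFull p).toLatticeSituation (scalSetting p) (scalRegion p) (PinnedWitness.qDatum p) ∧
      ¬ DictionaryRealizable (naiveFull p).toLatticeSituation (PinnedWitness.pinnedSetting p) (PinnedWitness.orbitRegion p)
          (PinnedWitness.qDatum p) :=
  ⟨floor_dictionaryRealizable p, scalSetting_dictionaryRealizable p, pinnedSetting_not_dictionaryRealizable p⟩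

/-! ## 2. The two satisfiable horns, side by side -/

/-- At X-07′ the honest q-datum `{(±q)_j}` is NOT the Θ-monoid `{(±q^{j²})_j}` (their regions at label `2` are `B_1 ≠ B_4`; E-t41's
`scalDictionary_nondegenerate` read on the data). [folklore] -/
theorem scal_qDatum_ne_Psi : PinnedWitness.qDatum p ≠ ((scalFull p).D (scalSetting p).n).Ψ := fun h => by
  have hne := (scalDictionary_nondegenerate p).2.2.1
  have h0 : (scalDictionary p).datum (scalDictionary p).base = ((scalFull p).toLatticeSituation.D (scalSetting p).n).Ψ :=
    scalDictionary_baseIsThetaPilot p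
  rw [h0, scalDictionary_datum_std] at hne
  exact hne h.symm

/-- **`dictionary_models_contrast`.** X-01's hypothesis set (`DictionaryRealizable`, together with the typed [IUTchIII] Thm. 3.11 (i)–(iii),
`|log(q)| > 0`, the THREE pins and S) is satisfiable in the tree in the two ways the location predicts: (i) DEGENERATELY — no move, volume-
INVARIANT indeterminacies, the q-datum IS the Θ-monoid, the typed Statement holds and is ATTAINED (this seat's floor p429619); (ii) NON-
DEGENERATELY — one rescaling (Ind2)-move (E-t41's `scalDictionary`), volume-NON-invariant indeterminacies, honest q-datum ≠ Θ-monoid,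
`−|log(Θ)| = ⊤` and the typed Statement FALSE (X-07′ p431886). By the calibration (p430744) both are models of S and of nothing more (one
place). Located, not adjudicated. [claim: Joshi2024ATS3, status: disputed] -/
theorem dictionary_models_contrast :
    (∃ (T : ThetaIndex) (F : FullSituation T) (P : Cor312.Setting F.toLatticeSituation.toSituation)
        (ρ : (∀ v : T.V, v ∈ T.Vbad → Set (F.L.StarPacket v)) → ∀ (j : T.Label) (vQ : T.VQ), Set (F.L.Packet j vQ))
        (qK : ∀ v : T.V, v ∈ T.Vbad → Set (F.L.StarPacket v)) (𝔇 : Dictionary F.toLatticeSituation),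
        F.Statement ∧ P.AbsLogQPos ∧ PinnedRegions3 F.toLatticeSituation P ρ qK ∧ DictionaryRealizable F.toLatticeSituation P ρ qK ∧
          PilotKummerIndRelated F.toLatticeSituation P ρ qK ∧
          IsEmpty 𝔇.Move ∧ StandardPointIsQPilot ρ qK 𝔇 ∧ (F.D P.n).LogvolInvariant ∧ qK = (F.D P.n).Ψ ∧ P.Statement ∧
          P.negLogTheta = ((P.negLogQ : ℝ) : WithTop ℝ)) ∧
    (∃ (T : ThetaIndex) (F : FullSituation T) (P : Cor312.Setting F.toLatticeSituation.toSituation)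
        (ρ : (∀ v : T.V, v ∈ T.Vbad → Set (F.L.StarPacket v)) → ∀ (j : T.Label) (vQ : T.VQ), Set (F.L.Packet j vQ))
        (qK : ∀ v : T.V, v ∈ T.Vbad → Set (F.L.StarPacket v)) (𝔇 : Dictionary F.toLatticeSituation),
        F.Statement ∧ P.AbsLogQPos ∧ PinnedRegions3 F.toLatticeSituation P ρ qK ∧ DictionaryRealizable F.toLatticeSituation P ρ qK ∧
          PilotKummerIndRelated F.toLatticeSituation P ρ qK ∧
          Nonempty 𝔇.Move ∧ StandardPointIsQPilot ρ qK 𝔇 ∧ ¬ (F.D P.n).LogvolInvariant ∧ qK ≠ (F.D P.n).Ψ ∧ ¬ P.Statement ∧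
          P.negLogTheta = ⊤) := by
  haveI : Fact (Nat.Prime 2) := ⟨Nat.prime_two⟩
  exact ⟨⟨toyIndex, naiveFull 2, expSetting 2 expSq, ballOfMonoid 2, fun v _ => qDatumExp 2 expSq v, floorDictionary 2,
      naiveFull_statement 2, floor_absLogQPos 2, floor_pinnedRegions3 2, floor_dictionaryRealizable 2, floor_pilotKummerIndRelated 2,
      floor_isEmpty_move 2, floor_standardPointIsQPilot 2, floor_logvolInvariant 2, rfl, floor_statement_via_X01 2,
      (floor_statement_attained 2).2⟩,
    ⟨toyIndex, scalFull 2, scalSetting 2, scalRegion 2, PinnedWitness.qDatum 2, scalDictionary 2, scalFull_statement 2,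
      scalSetting_absLogQPos 2, scalSetting_pinnedRegions3 2, scalSetting_dictionaryRealizable 2, scalSetting_pilotKummerIndRelated 2,
      (scalDictionary_nondegenerate 2).1, scalDictionary_standardPointIsQPilot 2, scalSetting_not_logvolInvariant 2,
      scal_qDatum_ne_Psi 2, (scalSetting_not_statement_not_bridgeHyps 2).1, scalSetting_negLogTheta_eq_top 2⟩⟩

end Summit.ABC.IUTFork.Joshi

end
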